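import Summits.CriticalPhenomena.Ising3DConformalLimit.Theses.IsingEuclidUpgrade
import Literature.Probability.LatticeModels.PointwiseScalingLimitEtaExists
import HarnessLib

/-!
# Crux `IsingEuclidUpgrade.IsingEuclidUpgradeR2RotInvPowerLaw` (stmt-CriticalPhenomena-0634) — line
`Lines/dyadic_dini_isotropy.lean`

Crux-strategist seat `planner-cstrat-stmt-CriticalPhenomena-0634-s1-0`, 2026-08-17. Route
`route-CriticalPhenomena-IsingEuclidUpgrade` (rank-2 crux; item shared with LinkingParityCircles,
CurrentConnectionInvariance, InverseSquareTelemetry, BernsteinTemperature), sub-problem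
`Ising3DConformalLimit`. Line card: `Lines/dyadic_dini_isotropy.md`.

Write `G := criticalTwoPoint 3` (`⟨σ₀σ_x⟩⁺_{β_c(3)}` on `ℤ³`), `g(n) := G(n e₀)` (first axis),
`|x|₂ := √(∑ᵢ xᵢ²)`. The crux (r2) is `∃ Δ c, 0 < c ∧ G(x)·|x|₂^{2Δ} → c` along the cofinite filter.

The line cuts r2 along the seam AXIS × ANGLE and then cuts the axial pure power law along the seam
SCALING × CORRECTIONS-TO-SCALING:

* S1 `DyadicDiniLaw` / `stub_dyadicDiniLaw` — the dyadic scaling law of `g` WITH A POWER RATE: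
  `∃ Δ ω C, 0 < ω ∧ ∀ n ≥ 1, |g(2n)·4^Δ/g(n) − 1| ≤ C n^{−ω}` (Wegner corrections to scaling at the
  two-point / two-scale level; conjecturally `ω ≈ 0.83`). It is the input that kills slowly varying
  (logarithmic, log-log, log-periodic of period `log 2`-incommensurable …) factors: the summable rate
  makes `j ↦ log (g(m2^j)(m2^j)^{2Δ})` Cauchy, uniformly in `m`.
* S2 `IntegerDilationLaw` / `stub_integerDilationLaw` — the RATE-FREE scaling law of `g` under every
  integer dilation: `∃ Δ, ∀ k ≥ 1, g(kn)·k^{2Δ}/g(n) → 1` (regular variation of the axis two-point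
  function with index `−2Δ`; the `k = 2` case is item `ThresholdDilation.DyadicScalingLaw`). It is
  what identifies the tower limits `lim_j g(m2^j)(m2^j)^{2Δ}` for different odd parts `m`.
* S3 `RatioIsotropy` / `stub_ratioIsotropy` — asymptotic isotropy at the RATIO level, no exponent:
  `G(x) / g(⌊|x|₂⌋) → 1` cofinitely (the two-point function at `x` is asymptotic to the axis
  two-point function at the same Euclidean distance).

Proved here (no `sorry` outside the three stubs): the real-variable core
`tendsto_of_dyadicDini_of_dilation` (a positive sequence with a summable-rate doubling law and
rate-free dilation laws along the dyadic towers converges to a positive limit), the axial glue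
`axisPowerLaw_of : S1 → S2 → AxisPowerLaw` (`∃ Δ c > 0, g(n) n^{2Δ} → c`), the angular glue
`rotInvPowerLaw_of_axisPowerLaw_of_ratioIsotropy : AxisPowerLaw → S3 → r2` (this is also the glue
of the two-piece DECOMPOSITION r2 ⇐ AxisPowerLaw ∧ RatioIsotropy recorded in the strategist's
census), and the composition `IsingEuclidUpgradeR2RotInvPowerLaw_of : S1 → S2 → S3 → r2`
concluding the route decl BY NAME (hypotheses = the registered stubs by name through the
`__Registered.stub_…` aliases, device of `Cruxes/InverseSquareLaw/Lines/birth.lean`).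

Tree inputs: `criticalTwoPoint_axis_pos` (Simon–Lieb positivity on the axis,
`PointwiseScalingLimitEtaExists.lean`); Mathlib real analysis (`cauchySeq_of_le_geometric`,
`dist_le_of_le_geometric_of_tendsto₀`, `tendsto_nat_floor_div_atTop`). No monotonicity (MMS) and
no reflection positivity is used by the glue: they are where S1–S3 must come from, not the seam.

Disproof used: none exists for this crux (`ledger crux ls stmt-CriticalPhenomena-0634`: no
workfiles at registration; `ledger negatives --problem CriticalPhenomena` touches no Ising two-point
statement).
-/

noncomputable section

namespace Summit.CriticalPhenomena.Ising3DConformalLimit.Cruxes.IsingEuclidUpgradeR2RotInvPowerLaw.DyadicDiniIsotropy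

open Filter Topology Literature.Probability.LatticeModels

/-! ## The statements, named (plain `def`s — no gate-reserved attributes in a workfile) -/

/-- **S1 (dyadic scaling law with a power rate).** There are `Δ`, `ω > 0` and `C` with
`|⟨σ₀σ_{2n e₀}⟩·4^Δ/⟨σ₀σ_{n e₀}⟩ − 1| ≤ C n^{−ω}` for all `n ≥ 1` (critical `ℤ³` Ising, first axis). -/
def DyadicDiniLaw : Prop :=
  ∃ Δ ω C : ℝ, 0 < ω ∧ ∀ n : ℕ, 1 ≤ n → |Literature.Probability.LatticeModels.criticalTwoPoint 3 (Pi.single 0 ((2 * n : ℕ) : ℤ)) * (4 : ℝ) ^ Δ / Literature.Probability.LatticeModels.criticalTwoPoint 3 (Pi.single 0 ((n : ℕ) : ℤ)) - 1| ≤ C * (n : ℝ) ^ (-ω)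

/-- **S2 (rate-free integer-dilation scaling law = regular variation of the axis two-point function
with index `−2Δ`).** There is `Δ` with `⟨σ₀σ_{kn e₀}⟩·k^{2Δ}/⟨σ₀σ_{n e₀}⟩ → 1` as `n → ∞`, for every
`k ≥ 1`. -/
def IntegerDilationLaw : Prop :=
  ∃ Δ : ℝ, ∀ k : ℕ, 1 ≤ k → Filter.Tendsto (fun n : ℕ => Literature.Probability.LatticeModels.criticalTwoPoint 3 (Pi.single 0 ((k * n : ℕ) : ℤ)) * (k : ℝ) ^ (2 * Δ) / Literature.Probability.LatticeModels.criticalTwoPoint 3 (Pi.single 0 ((n : ℕ) : ℤ))) Filter.atTop (nhds 1)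

/-- **S3 (ratio isotropy).** `⟨σ₀σ_x⟩ / ⟨σ₀σ_{⌊|x|₂⌋ e₀}⟩ → 1` along the cofinite filter of `ℤ³`. -/
def RatioIsotropy : Prop :=
  Filter.Tendsto (fun x : Literature.Probability.LatticeModels.Site 3 => Literature.Probability.LatticeModels.criticalTwoPoint 3 x / Literature.Probability.LatticeModels.criticalTwoPoint 3 (Pi.single 0 ((⌊Real.sqrt (∑ i, ((x i : ℝ)) ^ 2)⌋₊ : ℕ) : ℤ))) Filter.cofinite (nhds 1)

/-- **D1 (axial pure power law)** — the first piece of the two-piece decomposition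
r2 ⇐ D1 ∧ S3: `∃ Δ c, 0 < c ∧ ⟨σ₀σ_{n e₀}⟩·n^{2Δ} → c`. Proved below from S1 ∧ S2. -/
def AxisPowerLaw : Prop :=
  ∃ Δ c : ℝ, 0 < c ∧ Filter.Tendsto (fun n : ℕ => Literature.Probability.LatticeModels.criticalTwoPoint 3 (Pi.single 0 ((n : ℕ) : ℤ)) * (n : ℝ) ^ (2 * Δ)) Filter.atTop (nhds c)

/-! ## The registered stubs (the only `sorry`s of the file), statements verbatim -/

/-- **S1 (dyadic scaling law with a power rate)** — statement `DyadicDiniLaw` verbatim. OPEN: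
stronger than two-point doubling (item 6150, open in print: Aizenman–Duminil-Copin 2021 Remark 5.10)
and than the rate-free dyadic law (item `ThresholdDilation.DyadicScalingLaw`); the rate is the
corrections-to-scaling exponent `ω > 0` (no marginal operator). Not implied by the crux. -/
theorem stub_dyadicDiniLaw :
    ∃ Δ ω C : ℝ, 0 < ω ∧ ∀ n : ℕ, 1 ≤ n → |Literature.Probability.LatticeModels.criticalTwoPoint 3 (Pi.single 0 ((2 * n : ℕ) : ℤ)) * (4 : ℝ) ^ Δ / Literature.Probability.LatticeModels.criticalTwoPoint 3 (Pi.single 0 ((n : ℕ) : ℤ)) - 1| ≤ C * (n : ℝ) ^ (-ω) := by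
  sorry

/-- **S2 (integer-dilation scaling law, rate-free)** — statement `IntegerDilationLaw` verbatim. OPEN
(a consequence of the crux; with Messager–Miracle-Solé monotonicity it is regular variation of the
axis two-point function, and its `k = 2` case already gives existence of `η`, tree theorem
`ThresholdDilationEta.etaOfDyadicLaw_proof`). -/
theorem stub_integerDilationLaw :
    ∃ Δ : ℝ, ∀ k : ℕ, 1 ≤ k → Filter.Tendsto (fun n : ℕ => Literature.Probability.LatticeModels.criticalTwoPoint 3 (Pi.single 0 ((k * n : ℕ) : ℤ)) * (k : ℝ) ^ (2 * Δ) / Literature.Probability.LatticeModels.criticalTwoPoint 3 (Pi.single 0 ((n : ℕ) : ℤ))) Filter.atTop (nhds 1) := by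
  sorry

/-- **S3 (ratio isotropy)** — statement `RatioIsotropy` verbatim. OPEN (a consequence of the crux;
rotation invariance of the critical two-point function on `ℤ³` at the ratio level, no exponent;
the continuum analogue for any full scaling limit is the tree theorem
`HyperoctahedralRPTwoPoint.kernel_rotation_invariant`). -/
theorem stub_ratioIsotropy :
    Filter.Tendsto (fun x : Literature.Probability.LatticeModels.Site 3 => Literature.Probability.LatticeModels.criticalTwoPoint 3 x / Literature.Probability.LatticeModels.criticalTwoPoint 3 (Pi.single 0 ((⌊Real.sqrt (∑ i, ((x i : ℝ)) ^ 2)⌋₊ : ℕ) : ℤ))) Filter.cofinite (nhds 1) := by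
  sorry

/-! ## Aliases keyed by the registered stub names (device of `Cruxes/InverseSquareLaw/Lines/birth.lean`) -/
namespace __Registered

/-- Alias of `DyadicDiniLaw` keyed by the registered stub name. -/
abbrev stub_dyadicDiniLaw : Prop := DyadicDiniLaw
/-- Alias of `IntegerDilationLaw` keyed by the registered stub name. -/
abbrev stub_integerDilationLaw : Prop := IntegerDilationLaw
/-- Alias of `RatioIsotropy` keyed by the registered stub name. -/
abbrev stub_ratioIsotropy : Prop := RatioIsotropy

end __Registered

/-! ## Real-variable core (no Ising input) -/

/-- `|log (1 + e)| ≤ 2|e|` for `|e| ≤ 1/2`. [folklore] -/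
theorem abs_log_one_add_le {e : ℝ} (he : |e| ≤ 1 / 2) : |Real.log (1 + e)| ≤ 2 * |e| := by
  have he' := abs_le.1 he
  have hpos : 0 < 1 + e := by linarith
  have habs : 0 ≤ |e| := abs_nonneg e
  rw [abs_le]
  constructor
  · -- lower bound: `log (1+e) ≥ 1 - (1+e)⁻¹ = e/(1+e) ≥ -2|e|`
    have h1 := Real.one_sub_inv_le_log_of_pos hpos
    have h2 : -(2 * |e|) ≤ 1 - (1 + e)⁻¹ := by
      rw [show (1 : ℝ) - (1 + e)⁻¹ = e / (1 + e) by field_simp; ring]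
      rcases le_total 0 e with h | h
      · have : 0 ≤ e / (1 + e) := div_nonneg h hpos.le
        linarith
      · rw [abs_of_nonpos h, le_div_iff₀ hpos]
        nlinarith
    linarith
  · have h1 := Real.log_le_sub_one_of_pos hpos
    linarith [le_abs_self e]

/-- **Core lemma.** Let `L : ℕ → ℝ` be positive on `n ≥ 1`, with a summable-rate doubling law
`|L(2n)/L(n) − 1| ≤ C n^{−ω}` (`ω > 0`, `n ≥ 1`) and rate-free dilation laws along the dyadic towers,
`L(m 2^j)/L(2^j) → 1` (`j → ∞`) for every `m ≥ 1`. Then `L` converges to a positive limit.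
Mechanism: for `m ≥ M₀` (`C m^{−ω} ≤ 1/2`) the sequence `j ↦ log L(m2^j)` has geometric increments
`≤ 2C m^{−ω} 2^{−jω}`, hence a limit `w(m)` with `|log L(m) − w(m)| ≤ 2C m^{−ω}/(1 − 2^{−ω})`; the
dilation laws force `w(m) = w(M₀)`; so `log L(m) → w(M₀)`. [folklore] -/
theorem tendsto_of_dyadicDini_of_dilation {L : ℕ → ℝ} (hpos : ∀ n, 1 ≤ n → 0 < L n)
    {C ω : ℝ} (hω : 0 < ω) (hdini : ∀ n : ℕ, 1 ≤ n → |L (2 * n) / L n - 1| ≤ C * (n : ℝ) ^ (-ω))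
    (hdil : ∀ m : ℕ, 1 ≤ m → Tendsto (fun j : ℕ => L (m * 2 ^ j) / L (2 ^ j)) atTop (𝓝 1)) :
    ∃ ℓ : ℝ, 0 < ℓ ∧ Tendsto L atTop (𝓝 ℓ) := by
  -- a nonnegative constant
  set C' : ℝ := max C 0 with hC'
  have hC'0 : 0 ≤ C' := le_max_right _ _
  have hdini' : ∀ n : ℕ, 1 ≤ n → |L (2 * n) / L n - 1| ≤ C' * (n : ℝ) ^ (-ω) := fun n hn =>
    (hdini n hn).trans (mul_le_mul_of_nonneg_right (le_max_left _ _) (Real.rpow_nonneg n.cast_nonneg _))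
  -- the ratio `r := 2^{-ω} < 1`
  set r : ℝ := (2 : ℝ) ^ (-ω) with hr
  have hr0 : 0 < r := Real.rpow_pos_of_pos two_pos _
  have hr1 : r < 1 := Real.rpow_lt_one_of_one_lt_of_neg one_lt_two (neg_neg_of_pos hω)
  -- `C' m^{-ω} → 0`, so choose `M₀ ≥ 1` with `C' m^{-ω} ≤ 1/2` for `m ≥ M₀`
  have hsmall : Tendsto (fun m : ℕ => C' * (m : ℝ) ^ (-ω)) atTop (𝓝 0) := by
    have h := (tendsto_rpow_neg_atTop hω).comp tendsto_natCast_atTop_atTop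
    simpa using h.const_mul C'
  obtain ⟨M₁, hM₁⟩ := eventually_atTop.1 (hsmall.eventually (ge_mem_nhds (by norm_num : (0 : ℝ) < 1 / 2)))
  set M₀ : ℕ := max M₁ 1 with hM₀
  have hM₀1 : 1 ≤ M₀ := le_max_right _ _
  have hM₀small : ∀ m : ℕ, M₀ ≤ m → C' * (m : ℝ) ^ (-ω) ≤ 1 / 2 := fun m hm =>
    hM₁ m ((le_max_left _ _).trans hm)
  -- increments along the dyadic tower over `m ≥ M₀`
  have hpow_pos : ∀ (m j : ℕ), 1 ≤ m → 0 < L (m * 2 ^ j) := fun m j hm =>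
    hpos _ (le_trans hm (Nat.le_mul_of_pos_right _ (Nat.two_pow_pos j)))
  have hstep : ∀ m : ℕ, M₀ ≤ m → ∀ j : ℕ,
      dist (Real.log (L (m * 2 ^ j))) (Real.log (L (m * 2 ^ (j + 1)))) ≤ (2 * C' * (m : ℝ) ^ (-ω)) * r ^ j := by
    intro m hm j
    have hm1 : 1 ≤ m := hM₀1.trans hm
    set n : ℕ := m * 2 ^ j with hn
    have hn1 : 1 ≤ n := le_trans hm1 (Nat.le_mul_of_pos_right _ (Nat.two_pow_pos j))
    have hLn : 0 < L n := hpos n hn1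
    have hL2n : 0 < L (2 * n) := hpos _ (by omega)
    have h2n : m * 2 ^ (j + 1) = 2 * n := by rw [hn, pow_succ]; ring
    -- the error term
    set e : ℝ := L (2 * n) / L n - 1 with he
    have hebound : |e| ≤ C' * (n : ℝ) ^ (-ω) := hdini' n hn1
    -- `n^{-ω} ≤ m^{-ω}` and `n^{-ω} = m^{-ω} r^j`
    have hmpos : (0 : ℝ) < m := by exact_mod_cast (show 0 < m by omega)
    have hn_eq : (n : ℝ) ^ (-ω) = (m : ℝ) ^ (-ω) * r ^ j := by
      rw [hn, Nat.cast_mul, Nat.cast_pow, Nat.cast_ofNat,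
        Real.mul_rpow hmpos.le (by positivity), hr, ← Real.rpow_natCast,
        ← Real.rpow_mul (by norm_num : (0 : ℝ) ≤ 2), ← Real.rpow_natCast,
        ← Real.rpow_mul (by norm_num : (0 : ℝ) ≤ 2), mul_comm (j : ℝ) (-ω)]
    have hle_half : |e| ≤ 1 / 2 := by
      refine hebound.trans ?_
      have hnm : (m : ℝ) ≤ n := by exact_mod_cast (Nat.le_mul_of_pos_right _ (Nat.two_pow_pos j) : m ≤ n)
      calc C' * (n : ℝ) ^ (-ω) ≤ C' * (m : ℝ) ^ (-ω) :=
            mul_le_mul_of_nonneg_left (Real.rpow_le_rpow_of_nonpos hmpos hnm (neg_nonpos.2 hω.le)) hC'0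
        _ ≤ 1 / 2 := hM₀small m hm
    have hlog : Real.log (L (2 * n)) - Real.log (L n) = Real.log (1 + e) := by
      rw [← Real.log_div hL2n.ne' hLn.ne', he]; ring_nf
    rw [h2n, Real.dist_eq, abs_sub_comm, hlog]
    calc |Real.log (1 + e)| ≤ 2 * |e| := abs_log_one_add_le hle_half
      _ ≤ 2 * (C' * (n : ℝ) ^ (-ω)) := by linarith
      _ = 2 * C' * (m : ℝ) ^ (-ω) * r ^ j := by rw [hn_eq]; ring
  -- limits along the towers and the tail bound at `j = 0`
  have hlim : ∀ m : ℕ, M₀ ≤ m → ∃ w : ℝ, Tendsto (fun j : ℕ => Real.log (L (m * 2 ^ j))) atTop (𝓝 w) ∧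
      |Real.log (L m) - w| ≤ 2 * C' * (m : ℝ) ^ (-ω) / (1 - r) := by
    intro m hm
    have hcs := cauchySeq_of_le_geometric r (2 * C' * (m : ℝ) ^ (-ω)) hr1 (hstep m hm)
    obtain ⟨w, hw⟩ := cauchySeq_tendsto_of_complete hcs
    refine ⟨w, hw, ?_⟩
    have h := dist_le_of_le_geometric_of_tendsto₀ r (2 * C' * (m : ℝ) ^ (-ω)) hr1 (hstep m hm) hw
    simpa [Real.dist_eq] using h
  choose! w hw_tendsto hw_tail using hlim
  -- exponentiate: `L (m 2^j) → exp (w m)`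
  have hexp : ∀ m : ℕ, M₀ ≤ m → Tendsto (fun j : ℕ => L (m * 2 ^ j)) atTop (𝓝 (Real.exp (w m))) := by
    intro m hm
    have h := (Real.continuous_exp.tendsto _).comp (hw_tendsto m hm)
    refine h.congr fun j => ?_
    simp only [Function.comp_apply]
    exact Real.exp_log (hpow_pos m j (hM₀1.trans hm))
  -- all tower limits agree with the one over `M₀`
  have hw_eq : ∀ m : ℕ, M₀ ≤ m → w m = w M₀ := by
    intro m hm
    have hm1 : 1 ≤ m := hM₀1.trans hm
    -- `L(m2^j)/L(M₀2^j) → 1` from the two dilation laws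
    have h1 : Tendsto (fun j : ℕ => (L (m * 2 ^ j) / L (2 ^ j)) / (L (M₀ * 2 ^ j) / L (2 ^ j))) atTop (𝓝 (1 / 1)) :=
      (hdil m hm1).div (hdil M₀ hM₀1) one_ne_zero
    have h1' : Tendsto (fun j : ℕ => L (m * 2 ^ j) / L (M₀ * 2 ^ j)) atTop (𝓝 1) := by
      rw [div_one] at h1
      refine h1.congr fun j => ?_
      have hLj : L (2 ^ j) ≠ 0 := (hpos _ (Nat.one_le_two_pow)).ne'
      have hLM : L (M₀ * 2 ^ j) ≠ 0 := (hpow_pos M₀ j hM₀1).ne'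
      field_simp
    -- and `→ exp (w m) / exp (w M₀)`
    have h2 : Tendsto (fun j : ℕ => L (m * 2 ^ j) / L (M₀ * 2 ^ j)) atTop (𝓝 (Real.exp (w m) / Real.exp (w M₀))) :=
      (hexp m hm).div (hexp M₀ le_rfl) (Real.exp_pos _).ne'
    have h3 : Real.exp (w m) / Real.exp (w M₀) = 1 := tendsto_nhds_unique h2 h1'
    have h4 : Real.exp (w m) = Real.exp (w M₀) := by
      rw [div_eq_one_iff_eq (Real.exp_pos _).ne'] at h3; exact h3
    exact Real.exp_injective h4
  -- conclusion: `log L m → w M₀`, hence `L m → exp (w M₀)`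
  set ℓ : ℝ := Real.exp (w M₀) with hℓ
  refine ⟨ℓ, Real.exp_pos _, ?_⟩
  have hlog_t : Tendsto (fun m : ℕ => Real.log (L m)) atTop (𝓝 (w M₀)) := by
    rw [← tendsto_sub_nhds_zero_iff]
    have hbound : ∀ᶠ m : ℕ in atTop, ‖Real.log (L m) - w M₀‖ ≤ 2 * C' * (m : ℝ) ^ (-ω) / (1 - r) := by
      refine eventually_atTop.2 ⟨M₀, fun m hm => ?_⟩
      rw [Real.norm_eq_abs, ← hw_eq m hm]
      exact hw_tail m hm
    refine squeeze_zero_norm' hbound ?_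
    have h := (tendsto_rpow_neg_atTop hω).comp tendsto_natCast_atTop_atTop
    have h' : Tendsto (fun m : ℕ => 2 * C' * (m : ℝ) ^ (-ω) / (1 - r)) atTop (𝓝 (2 * C' * 0 / (1 - r))) :=
      ((h.const_mul (2 * C')).div_const (1 - r))
    simpa using h'
  have hL_t := (Real.continuous_exp.tendsto _).comp hlog_t
  refine hL_t.congr' ?_
  refine eventually_atTop.2 ⟨1, fun m hm => ?_⟩
  simp only [Function.comp_apply]
  exact Real.exp_log (hpos m hm)

/-! ## Axial glue: S1 ∧ S2 ⇒ D1 -/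

/-- `4^Δ = 2^(2Δ)`. [folklore] -/
theorem four_rpow_eq (Δ : ℝ) : (4 : ℝ) ^ Δ = (2 : ℝ) ^ (2 * Δ) := by
  rw [Real.rpow_mul (by norm_num : (0 : ℝ) ≤ 2), Real.rpow_two]; norm_num

/-- **S1 ∧ S2 ⇒ D1 (axial pure power law).** The two exponents coincide (both are the limit of the
doubling ratio); with `L(n) := ⟨σ₀σ_{n e₀}⟩ n^{2Δ}`, S1 is the summable-rate doubling law and S2 the
dilation laws of the core lemma. [folklore] -/
theorem axisPowerLaw_of (h1 : DyadicDiniLaw) (h2 : IntegerDilationLaw) : AxisPowerLaw := by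
  obtain ⟨Δ₁, ω, C, hω, hdini⟩ := h1
  obtain ⟨Δ, hdil⟩ := h2
  -- abbreviations
  set g : ℕ → ℝ := fun n => criticalTwoPoint 3 (Pi.single 0 ((n : ℕ) : ℤ)) with hg
  have gpos : ∀ n, 0 < g n := fun n => criticalTwoPoint_axis_pos n
  -- Step B: `Δ₁ = Δ` — both `g(2n)4^{Δ₁}/g(n)` and `g(2n)2^{2Δ}/g(n)` tend to `1`
  have hT1 : Tendsto (fun n : ℕ => g (2 * n) * (4 : ℝ) ^ Δ₁ / g n) atTop (𝓝 1) := by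
    rw [← tendsto_sub_nhds_zero_iff]
    have hbound : ∀ᶠ n : ℕ in atTop, ‖g (2 * n) * (4 : ℝ) ^ Δ₁ / g n - 1‖ ≤ C * (n : ℝ) ^ (-ω) :=
      eventually_atTop.2 ⟨1, fun n hn => by rw [Real.norm_eq_abs]; exact hdini n hn⟩
    refine squeeze_zero_norm' hbound ?_
    have h := (tendsto_rpow_neg_atTop hω).comp tendsto_natCast_atTop_atTop
    simpa using h.const_mul C
  have hT2 : Tendsto (fun n : ℕ => g (2 * n) * (2 : ℝ) ^ (2 * Δ) / g n) atTop (𝓝 1) := by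
    have h := hdil 2 (by norm_num)
    refine h.congr fun n => ?_
    simp only [hg, Nat.cast_ofNat]
  have hΔ : Δ₁ = Δ := by
    have hq : Tendsto (fun n : ℕ => (g (2 * n) * (4 : ℝ) ^ Δ₁ / g n) / (g (2 * n) * (2 : ℝ) ^ (2 * Δ) / g n))
        atTop (𝓝 (1 / 1)) := hT1.div hT2 one_ne_zero
    have hconst : Tendsto (fun _ : ℕ => (4 : ℝ) ^ Δ₁ / (2 : ℝ) ^ (2 * Δ)) atTop (𝓝 (1 / 1)) := by
      refine hq.congr fun n => ?_
      have h2n : g (2 * n) ≠ 0 := (gpos _).ne'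
      have hn : g n ≠ 0 := (gpos _).ne'
      have h4 : (4 : ℝ) ^ Δ₁ ≠ 0 := (Real.rpow_pos_of_pos (by norm_num) _).ne'
      have h22 : (2 : ℝ) ^ (2 * Δ) ≠ 0 := (Real.rpow_pos_of_pos (by norm_num) _).ne'
      field_simp
    rw [div_one] at hconst
    have heq : (4 : ℝ) ^ Δ₁ / (2 : ℝ) ^ (2 * Δ) = 1 := tendsto_nhds_unique tendsto_const_nhds hconst
    rw [div_eq_one_iff_eq (Real.rpow_pos_of_pos (by norm_num) _).ne', ← four_rpow_eq] at heq
    -- `4^{Δ₁} = 4^{Δ}` ⇒ `Δ₁ = Δ`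
    have hlog := congrArg Real.log heq
    rw [Real.log_rpow (by norm_num : (0 : ℝ) < 4), Real.log_rpow (by norm_num : (0 : ℝ) < 4)] at hlog
    have hl4 : Real.log 4 ≠ 0 := (Real.log_pos (by norm_num : (1 : ℝ) < 4)).ne'
    exact mul_right_cancel₀ hl4 hlog
  subst hΔ
  -- the renormalised axis sequence
  set L : ℕ → ℝ := fun n => g n * (n : ℝ) ^ (2 * Δ₁) with hL
  have Lpos : ∀ n, 1 ≤ n → 0 < L n := fun n hn =>
    mul_pos (gpos n) (Real.rpow_pos_of_pos (by exact_mod_cast hn) _)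
  -- S1 for `L`
  have hdiniL : ∀ n : ℕ, 1 ≤ n → |L (2 * n) / L n - 1| ≤ C * (n : ℝ) ^ (-ω) := by
    intro n hn
    have hnpos : (0 : ℝ) < n := by exact_mod_cast hn
    have hid : L (2 * n) / L n = g (2 * n) * (4 : ℝ) ^ Δ₁ / g n := by
      simp only [hL]
      have hgn : g n ≠ 0 := (gpos n).ne'
      have hnr : (n : ℝ) ^ (2 * Δ₁) ≠ 0 := (Real.rpow_pos_of_pos hnpos _).ne'
      rw [Nat.cast_mul, Nat.cast_ofNat, Real.mul_rpow (by norm_num : (0 : ℝ) ≤ 2) hnpos.le,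
        ← four_rpow_eq]
      field_simp
    rw [hid]
    exact hdini n hn
  -- S2 for `L` along the towers
  have hdilL : ∀ m : ℕ, 1 ≤ m → Tendsto (fun j : ℕ => L (m * 2 ^ j) / L (2 ^ j)) atTop (𝓝 1) := by
    intro m hm
    have hmpos : (0 : ℝ) < m := by exact_mod_cast hm
    have h := (hdil m hm).comp (tendsto_pow_atTop_atTop_of_one_lt one_lt_two)
    refine h.congr fun j => ?_
    simp only [Function.comp_apply, hL, hg]
    have h2j : (0 : ℝ) < ((2 ^ j : ℕ) : ℝ) := by positivity
    have hgj : criticalTwoPoint 3 (Pi.single 0 (((2 ^ j : ℕ) : ℕ) : ℤ)) ≠ 0 := (gpos (2 ^ j)).ne'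
    have hr : ((2 ^ j : ℕ) : ℝ) ^ (2 * Δ₁) ≠ 0 := (Real.rpow_pos_of_pos h2j _).ne'
    rw [show ((m * 2 ^ j : ℕ) : ℝ) = (m : ℝ) * ((2 ^ j : ℕ) : ℝ) from Nat.cast_mul m (2 ^ j),
      Real.mul_rpow hmpos.le h2j.le]
    field_simp
  obtain ⟨ℓ, hℓ, hlim⟩ := tendsto_of_dyadicDini_of_dilation Lpos hω hdiniL hdilL
  exact ⟨Δ₁, ℓ, hℓ, hlim⟩

/-! ## Angular glue: D1 ∧ S3 ⇒ r2 (the glue of the decomposition AxisPowerLaw ∧ RatioIsotropy → crux) -/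

/-- The sup norm of `x : ℤ³` is at most its Euclidean length. [folklore] -/
theorem norm_le_sqrt_sum_sq (x : Site 3) : ‖x‖ ≤ Real.sqrt (∑ i, ((x i : ℝ)) ^ 2) := by
  refine (pi_norm_le_iff_of_nonneg (Real.sqrt_nonneg _)).2 fun i => ?_
  rw [Int.norm_eq_abs]
  refine Real.abs_le_sqrt ?_
  exact Finset.single_le_sum (f := fun j => ((x j : ℝ)) ^ 2) (fun j _ => sq_nonneg _) (Finset.mem_univ i)

/-- The Euclidean length tends to `+∞` along the cofinite filter of `ℤ³`. [folklore] -/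
theorem tendsto_sqrt_sum_sq_cofinite :
    Tendsto (fun x : Site 3 => Real.sqrt (∑ i, ((x i : ℝ)) ^ 2)) cofinite atTop := by
  have hnorm : Tendsto (fun x : Site 3 => ‖x‖) cofinite atTop := by
    rw [← Filter.cocompact_eq_cofinite (Site 3)]
    exact tendsto_norm_cocompact_atTop
  exact tendsto_atTop_mono norm_le_sqrt_sum_sq hnorm

/-- **D1 ∧ S3 ⇒ r2.** With `n_x := ⌊|x|₂⌋`:
`G(x)|x|₂^{2Δ} = (G(x)/g(n_x)) · (g(n_x) n_x^{2Δ}) · (|x|₂/n_x)^{2Δ} → 1 · c · 1`. This is the glue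
`AxisPowerLaw → RatioIsotropy → IsingEuclidUpgradeR2RotInvPowerLaw` of the strategist's two-piece
decomposition of the crux. [folklore] -/
theorem rotInvPowerLaw_of_axisPowerLaw_of_ratioIsotropy (hD1 : AxisPowerLaw) (hS3 : RatioIsotropy) :
    Summit.CriticalPhenomena.Ising3DConformalLimit.Theses.IsingEuclidUpgrade.IsingEuclidUpgradeR2RotInvPowerLaw := by
  obtain ⟨Δ, c, hc, haxis⟩ := hD1
  unfold RatioIsotropy at hS3
  refine ⟨Δ, c, hc, ?_⟩
  -- notation
  set E : Site 3 → ℝ := fun x => Real.sqrt (∑ i, ((x i : ℝ)) ^ 2) with hE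
  set N : Site 3 → ℕ := fun x => ⌊E x⌋₊ with hN
  set g : ℕ → ℝ := fun n => criticalTwoPoint 3 (Pi.single 0 ((n : ℕ) : ℤ)) with hg
  have gpos : ∀ n, 0 < g n := fun n => criticalTwoPoint_axis_pos n
  have hE_top : Tendsto E cofinite atTop := tendsto_sqrt_sum_sq_cofinite
  have hN_top : Tendsto N cofinite atTop := tendsto_nat_floor_atTop.comp hE_top
  -- the three factors
  have hA : Tendsto (fun x => criticalTwoPoint 3 x / g (N x)) cofinite (𝓝 1) := hS3
  have hB : Tendsto (fun x => g (N x) * ((N x : ℕ) : ℝ) ^ (2 * Δ)) cofinite (𝓝 c) := haxis.comp hN_top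
  have hC0 : Tendsto (fun x => ((N x : ℕ) : ℝ) / E x) cofinite (𝓝 1) :=
    (tendsto_nat_floor_div_atTop (R := ℝ)).comp hE_top
  have hC1 : Tendsto (fun x => E x / ((N x : ℕ) : ℝ)) cofinite (𝓝 1) := by
    have h := hC0.inv₀ one_ne_zero
    rw [inv_one] at h
    refine h.congr fun x => ?_
    simp only [inv_div]
  have hC : Tendsto (fun x => (E x / ((N x : ℕ) : ℝ)) ^ (2 * Δ)) cofinite (𝓝 1) := by
    have h := hC1.rpow_const (p := 2 * Δ) (Or.inl one_ne_zero)
    simpa using h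
  have hprod : Tendsto (fun x => (criticalTwoPoint 3 x / g (N x)) * (g (N x) * ((N x : ℕ) : ℝ) ^ (2 * Δ)) *
      (E x / ((N x : ℕ) : ℝ)) ^ (2 * Δ)) cofinite (𝓝 c) := by
    have h := (hA.mul hB).mul hC
    simpa using h
  -- eventually `N x ≥ 1`, where the product is the target function
  have hev : ∀ᶠ x : Site 3 in cofinite, 1 ≤ N x := hN_top.eventually (eventually_ge_atTop 1)
  refine hprod.congr' ?_
  filter_upwards [hev] with x hx
  have hNpos : (0 : ℝ) < ((N x : ℕ) : ℝ) := by exact_mod_cast hx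
  have hEnn : 0 ≤ E x := Real.sqrt_nonneg _
  have hgN : g (N x) ≠ 0 := (gpos _).ne'
  have hsplit : E x ^ (2 * Δ) = ((N x : ℕ) : ℝ) ^ (2 * Δ) * (E x / ((N x : ℕ) : ℝ)) ^ (2 * Δ) := by
    rw [← Real.mul_rpow hNpos.le (div_nonneg hEnn hNpos.le), mul_div_cancel₀ _ hNpos.ne']
  rw [hsplit]
  field_simp

/-! ## Composition: the stubs conclude the crux BY NAME -/

/-- **The skeleton theorem (kernel-checked, sorry-free).** `S1 → S2 → S3 → r2`, hypotheses = the
registered stubs by name, conclusion = the route decl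
`Theses.IsingEuclidUpgrade.IsingEuclidUpgradeR2RotInvPowerLaw`: S1 ∧ S2 give the axial pure power
law (`axisPowerLaw_of`), S3 transports it to every direction
(`rotInvPowerLaw_of_axisPowerLaw_of_ratioIsotropy`). -/
theorem IsingEuclidUpgradeR2RotInvPowerLaw_of (h1 : __Registered.stub_dyadicDiniLaw)
    (h2 : __Registered.stub_integerDilationLaw) (h3 : __Registered.stub_ratioIsotropy) :
    Summit.CriticalPhenomena.Ising3DConformalLimit.Theses.IsingEuclidUpgrade.IsingEuclidUpgradeR2RotInvPowerLaw :=
  rotInvPowerLaw_of_axisPowerLaw_of_ratioIsotropy (axisPowerLaw_of h1 h2) h3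

/-- The crux from the registered stubs, applied literally (checks that statements, aliases and stubs
agree; sorry-free once every `stub_…` is replaced by its landed proof; its type is the route decl). -/
theorem IsingEuclidUpgradeR2RotInvPowerLaw_of_stubs :
    Summit.CriticalPhenomena.Ising3DConformalLimit.Theses.IsingEuclidUpgrade.IsingEuclidUpgradeR2RotInvPowerLaw :=
  IsingEuclidUpgradeR2RotInvPowerLaw_of stub_dyadicDiniLaw stub_integerDilationLaw stub_ratioIsotropy

end Summit.CriticalPhenomena.Ising3DConformalLimit.Cruxes.IsingEuclidUpgradeR2RotInvPowerLaw.DyadicDiniIsotropy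

end
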